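import Summits.QuantumFields.YangMills.Theorems.BalabanUVNodesN15PerCubeGreenKnit335Inverse
import Summits.QuantumFields.YangMills.Theorems.BalabanUVNodesN15TraceFormCoordinates
import HarnessLib

/-!
# N15 = NE2, road (c) — PROGRAMME (PC), (PC-F) «the per-cube KNIT», VII — NON-VACUITY AT NON-CONSTANT BACKGROUNDS: the inverse-with-decay of n15-c∕321 FIRES for EVERY PURE GAUGE
# `U = (v(x)v(x+e_μ)⁻¹)`, `v` a unitary site field, with NO further hypothesis (dag-n15-c g30, n15-c∕322)

Cell `pub-ymgap`, seat `pub-ymgap-dag-n15-c` (generation g30; R134 (a), s1; HUMAN RULING D-0062).  `bears_on: R4∕N15 · K3⁸ SpineGivenEndpointR13SepCoPHV (stmt-QuantumFields-27366)`;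
filed `--kind proof --supports stmt-QuantumFields-27366 --as helper` — COUNT-NEUTRAL.  Four theorems, 0 `def`, 0 `sorry`.  Imports BY NAME n15-c∕321 `…PerCubeGreenKnit335Inverse`
(★★★★★ `exists_inverse_decay_of_reg335Cube`; through it dag-n15-w2's `uN_reg335Cube_pureGauge`: every pure gauge of a unitary site field is in r06's class (3.35) on every cube, for all
`ξ, C > 0`).  Nothing in the tree is modified.

WHY (the referee's A2∕A6 question for n15-c∕319–321: are the hypotheses INHABITED by non-constant `U(m)` configurations?).  Yes: a pure gauge `U_μ(x) = v(x)v(x+e_μ)⁻¹` is in `Reg335Cube`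
on every box with potential `A = 0` and gauge `v`, for every `ξ, C > 0`; taking `ξ = 1`, `C = min 1 ε₀` meets n15-c∕321's smallness, so the whole chain n15-c∕316 → 321 runs with NO displayed
hypothesis beyond «`v` unitary, `k ≥ 1`, `L^m ≥ w₂(e)`».  (A pure gauge is gauge-equivalent to `U ≡ 1`; the point is inhabitation at genuinely non-constant configurations, as in n15-c∕267.)

WHAT.  ★★★ `exists_inverse_decay_pureGauge` (+ `…_tf` in the explicit coordinates `tfCoords`, the trace-form hypothesis `he` discharged by n15-c∕`traceForm_eq_tfCoords_dotProduct`; + `…_instance`: `d = 3`, `L = 17`, `M₂(ℂ)`, `a₀ = a = 1`, NO hypotheses beyond «`v` unitary») — for odd `L ≥ 17`, `a₀, a > 0`, colour `ι`: `∃ δ B > 0`, for all trace-form coordinates `e` of `M_m(ℂ)`: `∃ w₂`, on every doubled torus of the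
cover (`k ≥ 1`, `L^m ≥ w₂`), for EVERY unitary site field `v`: `∃ G, G ≤ B·e^{−(δ∕16)|y−y′|_T}` blockwise, `G∘A_U = 1`, `A_U∘G = 1` for `U = (v(x)v(x+e_μ)⁻¹)`,
`A_U = Δ_{R_U} + a·Q*(U)Q(U) − D_U(I−R(U))D*_U`.

HONEST FRAMING ∕ LIMITS.  Inhabitation certificate on MODEL carriers (as n15-c∕321); nothing of [Balaban1985BackgroundPropagators] asserted; NE2⁺ NOT PRINTED, NOT proved; N15 of record
untouched (DISCHARGED AS CONSUMED, p687738); K3⁸ OPEN; counts UNMOVED (typed 28∕28); one finite 𝕋⁴ at fixed ε per index — NOT infinite volume, NOT OS on ℝ⁴, NOT a mass gap, NOT Clay.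
Restate-immune (no Theses import).
-/

noncomputable section

open scoped BigOperators Matrix Matrix.Norms.L2Operator

namespace Summit.QuantumFields.YangMills.BalabanUVNodes.N15.Gluing

open Real
open Literature.MathematicalPhysics.QuantumFieldTheory.Balaban1983to89
open Literature.MathematicalPhysics.QuantumFieldTheory.Balaban1983to89.B5Prop11Plancherel (Tor fine unitVec)
open Literature.MathematicalPhysics.QuantumFieldTheory.Balaban1983to89.B11SectG (BlockNorm HasMaj)
open Literature.MathematicalPhysics.QuantumFieldTheory.Balaban1983to89.B6Prop26Gluing (mulOp)
open Literature.MathematicalPhysics.QuantumFieldTheory.Balaban1983to89.B6UnitTorusCarrier (unitTorusGeo)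
open Literature.MathematicalPhysics.QuantumFieldTheory.Balaban1983to89.B9Eq335RegularityClasses (Reg335Cube)
open Literature.MathematicalPhysics.QuantumFieldTheory.Balaban1983to89.B9Eq3117Current (gaugeTr)
open Literature.MathematicalPhysics.QuantumFieldTheory.King1986.Torus (blockOf)
open Literature.Barriers.QuantumFields (traceForm)
open Summit.QuantumFields.YangMills.BalabanUVNodes.N15.BackgroundLayer (covLapM)
open Summit.QuantumFields.YangMills.BalabanUVNodes.N15.VectorPiece (bshiftEquiv)
open Summit.QuantumFields.YangMills.BalabanUVNodes.N15.MatrixSpecies (coordMat)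
open Summit.QuantumFields.YangMills.BalabanUVNodes.N15.TwoGrid (cubeBlocks)
open Summit.QuantumFields.YangMills.BalabanUVNodes.N15.CurvedSpecies (gaugePair uN_reg335Cube_pureGauge)
open Summit.QuantumFields.YangMills.BalabanUVNodes.N15.TraceFormCoords (tfCoords traceForm_eq_tfCoords_dotProduct)

variable {d : ℕ} {L : ℕ} [NeZero L]

/-- ★★★ **NON-VACUITY OF n15-c∕321 AT NON-CONSTANT BACKGROUNDS**: for odd `L ≥ 17`, `a₀, a > 0`, colour `ι`: `∃ δ B > 0`, for all trace-form coordinates `e`: `∃ w₂`, on every doubled torus of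
the cover (`k ≥ 1`, `L^m ≥ w₂`), for EVERY unitary site field `v`, Bałaban's operator at the PURE GAUGE `U = (v(x)v(x+e_μ)⁻¹)` has a two-sided inverse `G ≤ B·e^{−(δ∕16)d}` blockwise — the
class datum (`ξ = 1`, `C = min 1 ε₀`, `A = 0`, gauge `v`) EXHIBITED by dag-n15-w2's `uN_reg335Cube_pureGauge`. [cite: Balaban1985BackgroundPropagators, (3.28) p.395, (3.35) p.396, Thm 3.1 p.397 (shape)] -/
theorem exists_inverse_decay_pureGauge (hL : Odd L ∧ 1 < L) (hL17 : 17 ≤ L) {a₀ : ℝ} (ha₀ : 0 < a₀) {a : ℝ} (ha : 0 < a) (ι : Type) [Fintype ι] [DecidableEq ι] :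
    ∃ δ B : ℝ, 0 < δ ∧ 0 < B ∧
      ∀ {mm : Type} [Fintype mm] [DecidableEq mm] [Nonempty mm] (e : Matrix mm mm ℂ ≃L[ℝ] (ι → ℝ)), (∀ A B : Matrix mm mm ℂ, traceForm A B = e A ⬝ᵥ e B) →
      ∃ w₂ : ℝ,
      ∀ (mv kk : ℕ), 1 ≤ kk → w₂ ≤ ((L ^ mv : ℕ) : ℝ) →
      ∀ (v : ScX d L mv kk hL → (Matrix mm mm ℂ)ˣ), (∀ x, (v x : Matrix mm mm ℂ) ∈ Matrix.unitaryGroup mm ℂ) →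
        ∃ G : (CvX d L mv kk hL × ι → ℝ) →ₗ[ℝ] (CvX d L mv kk hL × ι → ℝ),
          HasMaj (CvNorm d L mv kk hL ι) (CvNorm d L mv kk hL ι) G (fun y y' => B * Real.exp (-(δ / 16 * (unitTorusGeo L kk (cvM d L mv kk hL)).dist y y'))) ∧
          G ∘ₗ (covLapM (bshiftEquiv (cvM d L mv kk hL) (L ^ kk)) ((((L ^ kk : ℕ) : ℝ))⁻¹) (gaugePair (bshiftEquiv (cvM d L mv kk hL) (L ^ kk)) (fun μ x => coordMat e (ContinuousLinearMap.mulLeftRight ℝ (Matrix mm mm ℂ) ((gaugeTr (scShift d L mv kk hL) v (fun (_ : Fin (d + 1)) (_ : ScX d L mv kk hL) => (1 : (Matrix mm mm ℂ)ˣ)) μ x.1 : Matrix mm mm ℂ)) ((gaugeTr (scShift d L mv kk hL) v (fun (_ : Fin (d + 1)) (_ : ScX d L mv kk hL) => (1 : (Matrix mm mm ℂ)ˣ)) μ x.1 : Matrix mm mm ℂ))ᴴ))) + (cvNL d L mv kk hL a ι - cvNVq d L mv kk hL a ι e (fun μ x => (gaugeTr (scShift d L mv kk hL) v (fun (_ :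 Fin (d + 1)) (_ : ScX d L mv kk hL) => (1 : (Matrix mm mm ℂ)ˣ)) μ x.1 : Matrix mm mm ℂ)) - cvNVr d L mv kk hL a ι e (fun μ x => (gaugeTr (scShift d L mv kk hL) v (fun (_ : Fin (d + 1)) (_ : ScX d L mv kk hL) => (1 : (Matrix mm mm ℂ)ˣ)) μ x.1 : Matrix mm mm ℂ)))) = LinearMap.id ∧ (covLapM (bshiftEquiv (cvM d L mv kk hL) (L ^ kk)) ((((L ^ kk : ℕ) : ℝ))⁻¹) (gaugePair (bshiftEquiv (cvM d L mv kk hL) (L ^ kk)) (fun μ x => coordMat e (ContinuousLinearMap.mulLeftRight ℝ (Matrix mm mm ℂ) ((gaugeTr (scShift d L mv kk hL) v (fun (_ : Fin (d + 1)) (_ : ScX d L mv kk hL) => (1 : (Matrix mm mm ℂ)ˣ)) μ x.1 : Matrix mm mm ℂ)) ((gaugeTr (scShift d L mv kk hL) v (fun (_ : Fin (d + 1)) (_ : ScX d L mv kk hL) => (1 : (Matrix mm mm ℂ)ˣ)) μ x.1 : Matrix mm mm ℂ))ᴴ))) + (cvNL d L mv kk hL a ι - cvNVq d L mv kk hL a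 ι e (fun μ x => (gaugeTr (scShift d L mv kk hL) v (fun (_ : Fin (d + 1)) (_ : ScX d L mv kk hL) => (1 : (Matrix mm mm ℂ)ˣ)) μ x.1 : Matrix mm mm ℂ)) - cvNVr d L mv kk hL a ι e (fun μ x => (gaugeTr (scShift d L mv kk hL) v (fun (_ : Fin (d + 1)) (_ : ScX d L mv kk hL) => (1 : (Matrix mm mm ℂ)ˣ)) μ x.1 : Matrix mm mm ℂ)))) ∘ₗ G = LinearMap.id := by
  obtain ⟨δ, B, hδ, hB, H⟩ := exists_inverse_decay_of_reg335Cube (d := d) hL hL17 ha₀ ha ι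
  refine ⟨δ, B, hδ, hB, fun {mm} _ _ _ e he => ?_⟩
  obtain ⟨ε₀, w₂, hε0, H2⟩ := H e he
  refine ⟨w₂, fun mv kk hk hw => ?_⟩
  intro v hv
  -- the letters: `ξ = 1`, `C = min 1 ε₀` (every pure gauge is in the class for ALL `ξ, C > 0`)
  have hC0 : 0 < min 1 ε₀ := lt_min one_pos hε0
  have hC1 : min 1 ε₀ / 1 ≤ ε₀ := by rw [div_one]; exact min_le_right _ _
  have hC2 : min 1 ε₀ / 1 ^ 2 ≤ ε₀ := by rw [one_pow, div_one]; exact min_le_right _ _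
  have h335 := fun k : Fin (d + 1) → ZMod (2 * L) => (uN_reg335Cube_pureGauge (τ := scShift d L mv kk hL) (η := ((((L ^ kk : ℕ) : ℝ))⁻¹)) v hv
    {x : ScX d L mv kk hL | blockOf (L ^ kk) (cvM d L mv kk hL) x ∈ cubeBlocks (cvM d L mv kk hL) (coverCorner (cvM d L mv kk hL) (L ^ mv) L (L * L ^ mv + 6 * L ^ mv - coverMargin L mv + 1) k) (L * L ^ mv + 16 * L ^ mv + 4)} one_pos hC0).1
  have hU := (uN_reg335Cube_pureGauge (τ := scShift d L mv kk hL) (η := ((((L ^ kk : ℕ) : ℝ))⁻¹)) v hv (Set.univ : Set (ScX d L mv kk hL)) one_pos hC0).2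
  exact H2 mv kk hk hw (gaugeTr (scShift d L mv kk hL) v (fun (_ : Fin (d + 1)) (_ : ScX d L mv kk hL) => (1 : (Matrix mm mm ℂ)ˣ))) hU 1 (min 1 ε₀) one_pos hC0 hC1 hC2 h335


/-- ★★★ **THE SAME IN THE EXPLICIT TRACE-FORM COORDINATES `tfCoords` (n15-c∕`traceForm_eq_tfCoords_dotProduct`): no coordinate hypothesis left.**  For odd `L ≥ 17`, `a₀, a > 0`, colour
matrices `M_m(ℂ)` (`m ≥ 1`): `∃ δ B w₂`, on every doubled torus of the cover (`k ≥ 1`, `L^m ≥ w₂`), for EVERY unitary site field `v`, Bałaban's operator at the pure gauge `(v(x)v(x+e_μ)⁻¹)`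
has a two-sided inverse `G ≤ B·e^{−(δ∕16)d}` blockwise. [cite: Balaban1985BackgroundPropagators, (3.28) p.395, (3.35) p.396, Thm 3.1 p.397 (shape)] -/
theorem exists_inverse_decay_pureGauge_tf (hL : Odd L ∧ 1 < L) (hL17 : 17 ≤ L) {a₀ : ℝ} (ha₀ : 0 < a₀) {a : ℝ} (ha : 0 < a) (mm : Type) [Fintype mm] [DecidableEq mm] [Nonempty mm] :
    ∃ δ B w₂ : ℝ, 0 < δ ∧ 0 < B ∧
      ∀ (mv kk : ℕ), 1 ≤ kk → w₂ ≤ ((L ^ mv : ℕ) : ℝ) →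
      ∀ (v : ScX d L mv kk hL → (Matrix mm mm ℂ)ˣ), (∀ x, (v x : Matrix mm mm ℂ) ∈ Matrix.unitaryGroup mm ℂ) →
        ∃ G : (CvX d L mv kk hL × (Fin 2 × mm × mm) → ℝ) →ₗ[ℝ] (CvX d L mv kk hL × (Fin 2 × mm × mm) → ℝ),
          HasMaj (CvNorm d L mv kk hL (Fin 2 × mm × mm)) (CvNorm d L mv kk hL (Fin 2 × mm × mm)) G (fun y y' => B * Real.exp (-(δ / 16 * (unitTorusGeo L kk (cvM d L mv kk hL)).dist y y'))) ∧
          G ∘ₗ (covLapM (bshiftEquiv (cvM d L mv kk hL) (L ^ kk)) ((((L ^ kk : ℕ) : ℝ))⁻¹) (gaugePair (bshiftEquiv (cvM d L mv kk hL) (L ^ kk)) (fun μ x => coordMat (tfCoords mm) (ContinuousLinearMap.mulLeftRight ℝ (Matrix mm mm ℂ) ((gaugeTr (scShift d L mv kk hL) v (fun (_ : Fin (d + 1)) (_ : ScX d L mv kk hL) => (1 : (Matrix mm mm ℂ)ˣ)) μ x.1 : Matrix mm mm ℂ)) ((gaugeTr (scShift d L mv kk hL) v (fun (_ : Fin (d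 + 1)) (_ : ScX d L mv kk hL) => (1 : (Matrix mm mm ℂ)ˣ)) μ x.1 : Matrix mm mm ℂ))ᴴ))) + (cvNL d L mv kk hL a (Fin 2 × mm × mm) - cvNVq d L mv kk hL a (Fin 2 × mm × mm) (tfCoords mm) (fun μ x => (gaugeTr (scShift d L mv kk hL) v (fun (_ : Fin (d + 1)) (_ : ScX d L mv kk hL) => (1 : (Matrix mm mm ℂ)ˣ)) μ x.1 : Matrix mm mm ℂ)) - cvNVr d L mv kk hL a (Fin 2 × mm × mm) (tfCoords mm) (fun μ x => (gaugeTr (scShift d L mv kk hL) v (fun (_ : Fin (d + 1)) (_ : ScX d L mv kk hL) => (1 : (Matrix mm mm ℂ)ˣ)) μ x.1 : Matrix mm mm ℂ)))) = LinearMap.id ∧ (covLapM (bshiftEquiv (cvM d L mv kk hL) (L ^ kk)) ((((L ^ kk : ℕ) : ℝ))⁻¹) (gaugePair (bshiftEquiv (cvM d L mv kk hL) (L ^ kk)) (fun μ x => coordMat (tfCoords mm) (ContinuousLinearMap.mulLeftRight ℝ (Matrix mm mm ℂ) ((gaugeTr (scShift d L mv kk hL) v (fun (_ : Fin (d + 1))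 (_ : ScX d L mv kk hL) => (1 : (Matrix mm mm ℂ)ˣ)) μ x.1 : Matrix mm mm ℂ)) ((gaugeTr (scShift d L mv kk hL) v (fun (_ : Fin (d + 1)) (_ : ScX d L mv kk hL) => (1 : (Matrix mm mm ℂ)ˣ)) μ x.1 : Matrix mm mm ℂ))ᴴ))) + (cvNL d L mv kk hL a (Fin 2 × mm × mm) - cvNVq d L mv kk hL a (Fin 2 × mm × mm) (tfCoords mm) (fun μ x => (gaugeTr (scShift d L mv kk hL) v (fun (_ : Fin (d + 1)) (_ : ScX d L mv kk hL) => (1 : (Matrix mm mm ℂ)ˣ)) μ x.1 : Matrix mm mm ℂ)) - cvNVr d L mv kk hL a (Fin 2 × mm × mm) (tfCoords mm) (fun μ x => (gaugeTr (scShift d L mv kk hL) v (fun (_ : Fin (d + 1)) (_ : ScX d L mv kk hL) => (1 : (Matrix mm mm ℂ)ˣ)) μ x.1 : Matrix mm mm ℂ)))) ∘ₗ G = LinearMap.id := by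
  obtain ⟨δ, B, hδ, hB, H⟩ := exists_inverse_decay_pureGauge (d := d) hL hL17 ha₀ ha (Fin 2 × mm × mm)
  obtain ⟨w₂, H2⟩ := H (tfCoords mm) (traceForm_eq_tfCoords_dotProduct mm)
  exact ⟨δ, B, w₂, hδ, hB, H2⟩


/-- `17` is odd and exceeds `1`. [folklore] -/
theorem odd_seventeen_and_one_lt : Odd 17 ∧ 1 < 17 := ⟨⟨8, rfl⟩, by norm_num⟩

/-- ★★ **A CLOSED INSTANCE** (the referee's A2 as a kernel theorem): four Euclidean dimensions (`d = 3`), block size `L = 17`, colour matrices `M₂(ℂ)` in the coordinates `tfCoords`,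
reference mass `a₀ = 1`, mass letter `a = 1` — `∃ δ B w₂`, for all cover indices `k ≥ 1`, `17^m ≥ w₂` and EVERY unitary site field `v`, the inverse with decay exists; NO hypotheses beyond
«`v` unitary». [cite: Balaban1985BackgroundPropagators, Thm 3.1 p.397 (shape: MODEL level)] -/
theorem exists_inverse_decay_pureGauge_instance :
    ∃ δ B w₂ : ℝ, 0 < δ ∧ 0 < B ∧
      ∀ (mv kk : ℕ), 1 ≤ kk → w₂ ≤ ((17 ^ mv : ℕ) : ℝ) →
      ∀ (v : ScX 3 17 mv kk odd_seventeen_and_one_lt → (Matrix (Fin 2) (Fin 2) ℂ)ˣ), (∀ x, (v x : Matrix (Fin 2) (Fin 2) ℂ) ∈ Matrix.unitaryGroup (Fin 2) ℂ) →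
        ∃ G : (CvX 3 17 mv kk odd_seventeen_and_one_lt × (Fin 2 × Fin 2 × Fin 2) → ℝ) →ₗ[ℝ] (CvX 3 17 mv kk odd_seventeen_and_one_lt × (Fin 2 × Fin 2 × Fin 2) → ℝ),
          HasMaj (CvNorm 3 17 mv kk odd_seventeen_and_one_lt (Fin 2 × Fin 2 × Fin 2)) (CvNorm 3 17 mv kk odd_seventeen_and_one_lt (Fin 2 × Fin 2 × Fin 2)) G (fun y y' => B * Real.exp (-(δ / 16 * (unitTorusGeo 17 kk (cvM 3 17 mv kk odd_seventeen_and_one_lt)).dist y y'))) ∧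
          G ∘ₗ (covLapM (bshiftEquiv (cvM 3 17 mv kk odd_seventeen_and_one_lt) (17 ^ kk)) ((((17 ^ kk : ℕ) : ℝ))⁻¹) (gaugePair (bshiftEquiv (cvM 3 17 mv kk odd_seventeen_and_one_lt) (17 ^ kk)) (fun μ x => coordMat (tfCoords (Fin 2)) (ContinuousLinearMap.mulLeftRight ℝ (Matrix (Fin 2) (Fin 2) ℂ) ((gaugeTr (scShift 3 17 mv kk odd_seventeen_and_one_lt) v (fun (_ : Fin (3 + 1)) (_ : ScX 3 17 mv kk odd_seventeen_and_one_lt) => (1 : (Matrix (Fin 2) (Fin 2) ℂ)ˣ)) μ x.1 : Matrix (Fin 2) (Fin 2) ℂ)) ((gaugeTr (scShift 3 17 mv kk odd_seventeen_and_one_lt) v (fun (_ : Fin (3 + 1)) (_ : ScX 3 17 mv kk odd_seventeen_and_one_lt) => (1 : (Matrix (Fin 2) (Fin 2) ℂ)ˣ)) μ x.1 : Matrix (Fin 2) (Fin 2) ℂ))ᴴ))) + (cvNL 3 17 mv kk odd_seventeen_and_one_lt 1 (Fin 2 × Fin 2 × Fin 2) - cvNVq 3 17 mv kk odd_seventeen_and_one_lt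 1 (Fin 2 × Fin 2 × Fin 2) (tfCoords (Fin 2)) (fun μ x => (gaugeTr (scShift 3 17 mv kk odd_seventeen_and_one_lt) v (fun (_ : Fin (3 + 1)) (_ : ScX 3 17 mv kk odd_seventeen_and_one_lt) => (1 : (Matrix (Fin 2) (Fin 2) ℂ)ˣ)) μ x.1 : Matrix (Fin 2) (Fin 2) ℂ)) - cvNVr 3 17 mv kk odd_seventeen_and_one_lt 1 (Fin 2 × Fin 2 × Fin 2) (tfCoords (Fin 2)) (fun μ x => (gaugeTr (scShift 3 17 mv kk odd_seventeen_and_one_lt) v (fun (_ : Fin (3 + 1)) (_ : ScX 3 17 mv kk odd_seventeen_and_one_lt) => (1 : (Matrix (Fin 2) (Fin 2) ℂ)ˣ)) μ x.1 : Matrix (Fin 2) (Fin 2) ℂ)))) = LinearMap.id ∧ (covLapM (bshiftEquiv (cvM 3 17 mv kk odd_seventeen_and_one_lt) (17 ^ kk)) ((((17 ^ kk : ℕ) : ℝ))⁻¹) (gaugePair (bshiftEquiv (cvM 3 17 mv kk odd_seventeen_and_one_lt) (17 ^ kk)) (fun μ x => coordMat (tfCoords (Fin 2)) (ContinuousLinearMap.mulLeftRight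 ℝ (Matrix (Fin 2) (Fin 2) ℂ) ((gaugeTr (scShift 3 17 mv kk odd_seventeen_and_one_lt) v (fun (_ : Fin (3 + 1)) (_ : ScX 3 17 mv kk odd_seventeen_and_one_lt) => (1 : (Matrix (Fin 2) (Fin 2) ℂ)ˣ)) μ x.1 : Matrix (Fin 2) (Fin 2) ℂ)) ((gaugeTr (scShift 3 17 mv kk odd_seventeen_and_one_lt) v (fun (_ : Fin (3 + 1)) (_ : ScX 3 17 mv kk odd_seventeen_and_one_lt) => (1 : (Matrix (Fin 2) (Fin 2) ℂ)ˣ)) μ x.1 : Matrix (Fin 2) (Fin 2) ℂ))ᴴ))) + (cvNL 3 17 mv kk odd_seventeen_and_one_lt 1 (Fin 2 × Fin 2 × Fin 2) - cvNVq 3 17 mv kk odd_seventeen_and_one_lt 1 (Fin 2 × Fin 2 × Fin 2) (tfCoords (Fin 2)) (fun μ x => (gaugeTr (scShift 3 17 mv kk odd_seventeen_and_one_lt) v (fun (_ : Fin (3 + 1)) (_ : ScX 3 17 mv kk odd_seventeen_and_one_lt) => (1 : (Matrix (Fin 2) (Fin 2) ℂ)ˣ)) μ x.1 : Matrix (Fin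 2) (Fin 2) ℂ)) - cvNVr 3 17 mv kk odd_seventeen_and_one_lt 1 (Fin 2 × Fin 2 × Fin 2) (tfCoords (Fin 2)) (fun μ x => (gaugeTr (scShift 3 17 mv kk odd_seventeen_and_one_lt) v (fun (_ : Fin (3 + 1)) (_ : ScX 3 17 mv kk odd_seventeen_and_one_lt) => (1 : (Matrix (Fin 2) (Fin 2) ℂ)ˣ)) μ x.1 : Matrix (Fin 2) (Fin 2) ℂ)))) ∘ₗ G = LinearMap.id :=
  exists_inverse_decay_pureGauge_tf (d := 3) (L := 17) odd_seventeen_and_one_lt le_rfl one_pos one_pos (Fin 2)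

end Summit.QuantumFields.YangMills.BalabanUVNodes.N15.Gluing

end
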